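import Literature.Geometry.Kaehler.BlowUpDefectPieces
import Literature.Geometry.Kaehler.HolomorphicChainFactsProofs
import Literature.Geometry.Kaehler.HolomorphicChainTangentConeRegular
import Literature.Geometry.Kaehler.HolomorphicChainLelongProofs
import Literature.Geometry.GeometricMeasureTheory.BoundaryRectifiability
import Literature.Geometry.GeometricMeasureTheory.IntegralCurrentsFlatCompactness
import HarnessLib

/-!
# King's tangent cone theorem from the boundary rectifiability theorem

The named fact `Literature.Geometry.Kaehler.King1971_tangentCone` (King 1971, Thm. 5.1.6;
[Harvey1977, Thm. 1.31]) asserts the LOCALLY FLAT convergence, as `r → 0⁺`, of the blow-ups `D_r`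
of a holomorphic `p`-chain to a conic holomorphic `p`-chain `C`. The weak convergence
`D_r → [C(T,b)]` is proved in this tree (`TangentConeWeakLimit.lean`, `BlowUpDefect.lean`), and the
ball pieces `P_{r,t} = (D_r − [C]) ⌞ 𝐁(0,t)` are rectifiable currents on `V` of uniformly bounded
normal mass (`BlowUpDefectPieces.lean`). Federer's passage from weak to flat convergence
[Federer1969, 4.3.16] uses two theorems of the general theory:

* the flat-Cauchy half of the **compactness theorem** [Federer1969, 4.2.17 (2)] — a bounded
  sequence of integral currents has a subsequence converging in the integral flat norm to an
  integral flat chain — PROVED in this tree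
  (`Literature.Geometry.GeometricMeasureTheory.Current.exists_subseq_flatLimit_of_isIntegral`,
  `IntegralCurrentsFlatCompactness.lean`; the integrality of the limit, i.e. the closure theorem
  4.2.16 (1) and the full named fact
  `Literature.Geometry.GeometricMeasureTheory.Federer1969_compactness_integralCurrents`, is not
  needed here);
* the **boundary rectifiability theorem** [Federer1969, 4.2.16 (2)]:
  `𝓡_{m+1} ∩ {S : 𝐌(∂S) < ∞} = 𝐈_{m+1}` — the named fact
  `Literature.Geometry.GeometricMeasureTheory.Federer1969_boundaryRectifiability`, not proved in
  this tree, taken as a HYPOTHESIS.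

`King1971_tangentCone_pos_of_boundaryRectifiability` proves the conclusion of
`King1971_tangentCone` in every positive dimension `p = q + 1` from the second input alone (and
`King1971_tangentCone_zero` proves the case `p = 0` outright: the support of a `0`-chain consists
of regular points, `HasPureDim.mem_regularLocus_of_zero`, where the tree's
`King1971_tangentCone_of_notMem_singular` applies; `King1971_tangentCone_of_boundaryRectifiability'`
assembles all dimensions, and **`King1971_tangentCone_of_boundaryRectifiability :
Federer1969_boundaryRectifiability → King1971_tangentCone`** is the same with 4.2.16 (2) in the
form of the named fact): if the flat clause failed along radii `r_k → 0⁺`, the integral currents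
`P_k = P_{r_k,t_k}` (`t_k ∈ (ρ₁,ρ₂)` good spheres, `W̄ ⊆ 𝐁(0,ρ₁)`) would have a subsequence
converging in the integral flat norm to an integral flat chain `T'`; since
`P_k(φ) = (D_{r_k} − [C])(φ) → 0` for `φ` supported in `𝐁(0,ρ₁)`, `T'` vanishes there, and the
flat decompositions `P_{k_j} − T' = R_j + ∂S_j`, `𝐌(R_j) + 𝐌(S_j) → 0`, cut down to the unit
ball, contradict the failure of the flat clause at `r_{k_j}`. The earlier statements with the
(now redundant) compactness hypothesis — `King1971_tangentCone_pos_of_compactness`,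
`King1971_tangentCone_of_compactness`, `King1971_tangentCone_of_facts` — are kept as corollaries.

Theorems only; no new definitions, no named facts.

## References

* H. Federer, *Geometric Measure Theory*, Springer 1969, 4.1.7, 4.1.24, 4.2.16, 4.2.17, 4.3.16–4.3.18
  [Federer1969].
* R. Harvey, *Holomorphic chains and their boundaries*, PSPUM XXX.1 (1977), §1.10, Thm. 1.31
  [Harvey1977].
* J. R. King, *The currents defined by analytic varieties*, Acta Math. 127 (1971), Thm. 5.1.6.
-/

noncomputable section

open scoped Manifold Topology ENNReal NNReal InnerProductSpace ContDiff Distributions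
open Set Filter MeasureTheory Metric Function Module TopologicalSpace

namespace Literature.Geometry.Kaehler

open Literature.Geometry.GeometricMeasureTheory

-- Nested operator-norm instances on (duals of) `V [⋀^Fin n]→L[ℝ] ℝ`.
set_option maxSynthPendingDepth 2

universe u

/-! ### Plumbing -/

section Plumbing

variable {E : Type*} [NormedAddCommGroup E] [NormedSpace ℝ E] {Ω Ω' : Opens E} {m : ℕ}

/-- A current vanishing on all test forms supported in an open set `W` has no support in `W`.
[folklore] -/
private theorem support_inter_eq_empty_of_forall (X : Current Ω m) {W : Set E} (hW : IsOpen W)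
    (h : ∀ φ : TestForm Ω m, tsupport ⇑φ ⊆ W → X φ = 0) : X.support ∩ W = ∅ := by
  refine eq_empty_iff_forall_notMem.2 fun x hx => ?_
  obtain ⟨φ, hφ, hne⟩ := hx.1.2 W (hW.mem_nhds hx.2)
  exact hne (h φ hφ)

/-- `𝐌(X|Ω') ≤ 𝐌(X)`. [folklore] -/
private theorem mass_comp_monoCLM_le (hle : Ω' ≤ Ω) (X : Current Ω m) :
    Current.mass (X.comp (TestFunction.monoCLM ℝ) : Current Ω' m) ≤ X.mass := by
  refine iSup₂_le fun ψ hψ => ?_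
  rw [ContinuousLinearMap.comp_apply]
  exact X.ofReal_apply_le_mass fun x => by rw [TestForm.monoCLM_apply_of_le hle]; exact hψ x

/-- A test form on `Ω` supported in `Ω' ≤ Ω` comes from a test form on `Ω'`. [folklore] -/
private theorem exists_monoCLM_eq (hle : Ω' ≤ Ω) (φ : TestForm Ω m)
    (hφ : tsupport ⇑φ ⊆ (Ω' : Set E)) :
    ∃ ψ : TestForm Ω' m, (TestFunction.monoCLM ℝ ψ : TestForm Ω m) = φ ∧ ⇑ψ = ⇑φ := by
  refine ⟨⟨⇑φ, φ.contDiff, φ.hasCompactSupport, hφ⟩, ?_, rfl⟩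
  apply TestFunction.ext; intro x
  rw [TestForm.monoCLM_apply_of_le hle]; rfl

end Plumbing

/-! ### Cutting a rectifiable current of `V` down to the unit ball -/

section Cut

variable {V : Type u} [NormedAddCommGroup V] [InnerProductSpace ℂ V] [FiniteDimensional ℂ V]
  [MeasurableSpace V] [BorelSpace V] {m : ℕ}

/-- **Cutting a rectifiable current of `V` down to a ball inside the unit ball**: for
`R ∈ 𝓡_m(V)` of finite mass and `ρ < 1` there is `R' ∈ 𝓡_m(𝐁(0,1))` with `𝐌(R') ≤ 𝐌(R)` and
`R'(ψ) = R(ψ̃)` for every test form `ψ` on the unit ball supported in `𝐁(0,ρ)` (namely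
`R' = (R ⌞ 𝐁(0,ρ))|𝐁(0,1)`). [cite: Federer1969, 4.1.7, 4.1.28] -/
theorem exists_cut_unitBall {R : Current (⊤ : Opens V) m}
    (hR : letI : InnerProductSpace ℝ V := InnerProductSpace.complexToReal; R.IsRectifiable)
    (hRm : R.mass ≠ ⊤) {ρ : ℝ} (hρ : ρ < 1) :
    letI : InnerProductSpace ℝ V := InnerProductSpace.complexToReal
    ∃ R' : Current (unitBall V) m, R'.IsRectifiable ∧ R'.mass ≤ R.mass ∧
      ∀ ψ : TestForm (unitBall V) m, tsupport ⇑ψ ⊆ ball (0 : V) ρ →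
        R' ψ = R (TestFunction.monoCLM ℝ ψ) := by
  letI : InnerProductSpace ℝ V := InnerProductSpace.complexToReal
  haveI : FiniteDimensional ℝ V := FiniteDimensional.complexToReal V
  obtain ⟨⟨W, θ, ξ, hd, rfl⟩, -⟩ := hR
  have hle : unitBall V ≤ (⊤ : Opens V) := le_top
  have hdA := hd.inter (measurableSet_ball (x := (0 : V)) (ε := ρ))
  -- the cut-down data, read on the unit ball
  have hdA' : IsRectifiableData (unitBall V) m (W ∩ ball (0 : V) ρ ∩ ((unitBall V : Opens V) : Set V))
      θ ξ := hdA.inter_of_le hle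
  have hset : W ∩ ball (0 : V) ρ ∩ ((unitBall V : Opens V) : Set V) = W ∩ ball (0 : V) ρ :=
    inter_eq_left.2 (inter_subset_right.trans (ball_subset_ball hρ.le))
  rw [hset] at hdA'
  refine ⟨currentOfIntegration (W ∩ ball (0 : V) ρ) θ ξ, ⟨⟨_, _, _, hdA', rfl⟩, ?_⟩, ?_, ?_⟩
  · exact Current.isCompact_support_of_subset _ (isCompact_closedBall (0 : V) ρ)
      (closedBall_subset_ball hρ) ((support_currentOfIntegration_subset_closure _ _ _).trans
        (closure_minimal (inter_subset_right.trans ball_subset_closedBall) isClosed_closedBall))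
  · -- `𝐌(R') ≤ 𝐌(R ⌞ B) ≤ 𝐌(R)`
    rw [currentOfIntegration_eq_comp_monoCLM hle hdA.2.2.2.1]
    refine (mass_comp_monoCLM_le hle _).trans ?_
    rw [← hd.restrictSet_eq measurableSet_ball]
    exact (hd.isRepresentable.mass_restrictSet_le _).trans (Current.variation_le_mass _ _)
  · intro ψ hψ
    rw [currentOfIntegration_eq_comp_monoCLM hle hdA.2.2.2.1, ContinuousLinearMap.comp_apply,
      ← hd.restrictSet_eq measurableSet_ball]
    refine hd.isRepresentable.restrictSet_apply_of_support_subset _ ((subset_tsupport _).trans ?_)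
    rwa [TestForm.monoCLM_apply_of_le hle]

end Cut

/-! ### The reduction -/

section Reduction

variable {V : Type u} [NormedAddCommGroup V] [InnerProductSpace ℂ V] [FiniteDimensional ℂ V]
  [MeasurableSpace V] [BorelSpace V]

/-- **King's tangent cone theorem in positive dimension, from the boundary rectifiability theorem
4.2.16 (2).** For a holomorphic `p`-chain `T` (`p = q + 1`) on `Ω ⊆ V` and `b ∈ Ω`: the
conclusion of `King1971_tangentCone` — a conic holomorphic `p`-chain `C` on `V` (the tangent-cone
chain `C(T,b)`, or `0` off the support) such that for every open `W ⋐ 𝐁(0,1)` and `δ > 0`, for all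
small `r > 0`, `D_r − [C]⌞𝐁(0,1) = R + ∂S` on `W` with `R, S` rectifiable on the unit ball and
`𝐌(R) + 𝐌(S) < δ`. The flat-convergent subsequence of the ball pieces is supplied by
`Current.exists_subseq_flatLimit_of_isIntegral` (the flat-Cauchy half of [Federer1969, 4.2.17 (2)],
proved in this tree); the boundary rectifiability theorem makes the ball pieces integral.
[cite: Harvey1977, Thm. 1.31; Federer1969, 4.3.16, 4.2.17, 4.2.16] -/
theorem King1971_tangentCone_pos_of_boundaryRectifiability
    (h4216 : ∀ (E : Type u) [NormedAddCommGroup E] [InnerProductSpace ℝ E] [FiniteDimensional ℝ E]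
      [MeasurableSpace E] [BorelSpace E] (m : ℕ) (P : Current (⊤ : Opens E) (m + 1)),
      P.IsRectifiable → P.boundary.mass ≠ ⊤ → P.boundary.IsRectifiable)
    (Ω : Opens V) (q : ℕ) (T : HolomorphicChain 𝓘(ℂ, V) Ω (q + 1)) (b : V) (hb : b ∈ Ω) :
    letI : InnerProductSpace ℝ V := InnerProductSpace.complexToReal
    ∃ C : HolomorphicChain 𝓘(ℂ, V) (⊤ : Opens V) (q + 1),
      (∀ x ∈ C.support, ∀ c : ℂ, (⟨c • (x : V), trivial⟩ : (⊤ : Opens V)) ∈ C.support) ∧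
      ∀ (W : Set V), IsOpen W → IsCompact (closure W) → closure W ⊆ ball (0 : V) 1 →
        ∀ δ : ℝ≥0∞, 0 < δ → ∀ᶠ r in 𝓝[>] (0 : ℝ),
          ∃ (R : Current (unitBall V) (2 * (q + 1))) (S : Current (unitBall V) (2 * (q + 1) + 1)),
            R.IsRectifiable ∧ S.IsRectifiable ∧
            (T.blowUp b r - C.toCurrentIn (unitBall V) - R - S.boundary).support ∩ W = ∅ ∧
            R.mass + S.mass < δ := by
  letI : InnerProductSpace ℝ V := InnerProductSpace.complexToReal
  haveI : FiniteDimensional ℝ V := FiniteDimensional.complexToReal V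
  -- off the support: the tree's theorem
  by_cases hbT : b ∈ (((↑) : Ω → V) '' T.support)
  swap
  · exact King1971_tangentCone_of_notMem_support V Ω (q + 1) T b hb hbT
  have hne : T.support.Nonempty := by
    obtain ⟨x, hx, -⟩ := hbT; exact ⟨x, hx⟩
  have hA : HasPureDim 𝓘(ℂ, V) T.support (q + 1) := T.hasPureDim_support hne
  set C := HolomorphicChain.tangentConeChain T hA hb with hCdef
  refine ⟨C, fun x hx c => T.tangentConeChain_smul_mem_support hA hb hx c, ?_⟩
  intro W hWo hWc hW1 δ hδ
  -- radii `ρ₁ < ρ₂ < 1` with `W̄ ⊆ B(0, ρ₁)`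
  obtain ⟨ρ₀, hρ₀, hWρ₀⟩ := exists_pos_lt_subset_ball one_pos isClosed_closure hW1
  set ρ₁ : ℝ := max ρ₀ (1 / 2) with hρ₁
  have hρ₁0 : 0 < ρ₁ := lt_of_lt_of_le one_half_pos (le_max_right _ _)
  have hρ₁1 : ρ₁ < 1 := max_lt hρ₀.2 one_half_lt_one
  have hWρ₁ : W ⊆ ball (0 : V) ρ₁ :=
    subset_closure.trans (hWρ₀.trans (ball_subset_ball (le_max_left _ _)))
  set ρ₂ : ℝ := (ρ₁ + 1) / 2 with hρ₂
  have h12 : ρ₁ < ρ₂ := by rw [hρ₂]; linarith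
  have hρ₂1 : ρ₂ < 1 := by rw [hρ₂]; linarith
  -- the uniformly normal rectifiable ball pieces
  obtain ⟨c, hctop, hP⟩ := T.exists_ballPiece_normalMass_le C hb hρ₁0 h12 hρ₂1
  -- suppose the flat clause fails along `r_k → 0⁺`
  by_contra hcon
  have hfreq := (Filter.not_eventually.1 hcon).and_eventually hP
  obtain ⟨r, hr, hrk⟩ := exists_seq_forall_of_frequently hfreq
  choose hbad t ht hrect hspt hN hagree using hrk
  -- the pieces `P_k`, integral by the boundary rectifiability theorem
  set P : ℕ → Current (⊤ : Opens V) (2 * q + 1 + 1) := fun k =>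
    (T.blowUpPiece b (r k) (ball (0 : V) (t k)) -
      currentOfIntegration (C.carrier ∩ ball (0 : V) (t k)) C.density C.orientationFrame :
        Current (⊤ : Opens V) (2 * q + 1 + 1)) with hPdef
  have hPint : ∀ k, (P k).IsIntegral ∧ (P k).support ⊆ closedBall (0 : V) ρ₂ ∧
      (P k).normalMass ≤ c := by
    intro k
    have hbm : (P k).boundary.mass ≠ ⊤ :=
      ne_top_of_le_ne_top hctop ((le_add_self).trans (hN k))
    exact ⟨⟨hrect k, h4216 V (2 * q + 1) (P k) (hrect k) hbm⟩, hspt k, hN k⟩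
  -- the flat-Cauchy half of the compactness theorem: a flat-convergent subsequence
  obtain ⟨T', ι, hι, -, -, -, hflat, -⟩ :=
    Current.exists_subseq_flatLimit_of_isIntegral (2 * q) (0 : V) ρ₂ hctop P hPint
  have hweak : ∀ φ, Tendsto (fun j => P (ι j) φ) atTop (𝓝 (T' φ)) := fun φ =>
    Current.tendsto_apply_of_tendsto_integralFlatNorm hflat φ
  -- `r ∘ ι → 0⁺`
  have hrι : Tendsto (fun j => r (ι j)) atTop (𝓝[>] (0 : ℝ)) := hr.comp hι.tendsto_atTop
  -- `T'` vanishes on forms supported in `B(0, ρ₁)`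
  have hle : unitBall V ≤ (⊤ : Opens V) := le_top
  have hT'0 : ∀ φ : TestForm (⊤ : Opens V) (2 * q + 1 + 1), tsupport ⇑φ ⊆ ball (0 : V) ρ₁ →
      T' φ = 0 := by
    intro φ hφ
    obtain ⟨ψ, hψφ, hψ⟩ := exists_monoCLM_eq hle φ (hφ.trans (ball_subset_ball hρ₁1.le))
    have hψ1 : tsupport ⇑ψ ⊆ ball (0 : V) ρ₁ := by rw [hψ]; exact hφ
    have h1 : ∀ j, P (ι j) φ = (T.blowUp b (r (ι j)) - C.toCurrentIn (unitBall V)) ψ := by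
      intro j
      rw [← hψφ]
      exact hagree (ι j) ψ hψ1
    have h2 : Tendsto (fun j => P (ι j) φ) atTop (𝓝 0) := by
      simp_rw [h1]
      exact (T.tendsto_blowUp_sub_toCurrentIn_apply hA hb ψ).comp hrι
    exact tendsto_nhds_unique (hweak φ) h2
  -- a flat decomposition with small masses at some index
  obtain ⟨j, hj⟩ := (hflat.eventually (Iio_mem_nhds hδ)).exists
  obtain ⟨R, S, hRr, hSr, hRS, hmass⟩ := Current.exists_of_integralFlatNorm_lt hj
  have hRm : R.mass ≠ ⊤ := ne_top_of_lt (lt_of_le_of_lt le_self_add hmass)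
  have hSm : S.mass ≠ ⊤ := ne_top_of_lt (lt_of_le_of_lt le_add_self hmass)
  obtain ⟨R', hR'r, hR'm, hR'ψ⟩ := exists_cut_unitBall hRr hRm hρ₂1
  obtain ⟨S', hS'r, hS'm, hS'ψ⟩ := exists_cut_unitBall hSr hSm hρ₂1
  -- … contradicting the failure of the flat clause at `r (ι j)`
  refine hbad (ι j) ⟨R', S', hR'r, hS'r, ?_, ?_⟩
  · refine support_inter_eq_empty_of_forall _ hWo fun ψ hψW => ?_
    have hψ1 : tsupport ⇑ψ ⊆ ball (0 : V) ρ₁ := hψW.trans hWρ₁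
    have hψ2 : tsupport ⇑ψ ⊆ ball (0 : V) ρ₂ := hψ1.trans (ball_subset_ball h12.le)
    have e1 : (T.blowUp b (r (ι j)) - C.toCurrentIn (unitBall V)) ψ =
        P (ι j) (TestFunction.monoCLM ℝ ψ) := (hagree (ι j) ψ hψ1).symm
    have e2 : R' ψ = R (TestFunction.monoCLM ℝ ψ) := hR'ψ ψ hψ2
    have e3 : S'.boundary ψ = S.boundary (TestFunction.monoCLM ℝ ψ) := by
      rw [Current.boundary_apply, Current.boundary_apply,
        hS'ψ _ ((TestForm.tsupport_extDerivCLM_subset ψ).trans hψ2),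
        TestForm.extDerivCLM_monoCLM hle]
    have e4 : T' (TestFunction.monoCLM ℝ ψ) = 0 :=
      hT'0 _ (by rw [TestForm.monoCLM_apply_of_le hle]; exact hψ1)
    have e5 : P (ι j) (TestFunction.monoCLM ℝ ψ) - T' (TestFunction.monoCLM ℝ ψ) =
        R (TestFunction.monoCLM ℝ ψ) + S.boundary (TestFunction.monoCLM ℝ ψ) := by
      have := congrArg (fun X : Current (⊤ : Opens V) (2 * q + 1 + 1) =>
        X (TestFunction.monoCLM ℝ ψ)) hRS
      exact this
    show (T.blowUp b (r (ι j)) - C.toCurrentIn (unitBall V)) ψ - R' ψ - S'.boundary ψ = 0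
    rw [e1, e2, e3]
    rw [e4, sub_zero] at e5
    rw [e5]; ring
  · calc R'.mass + S'.mass ≤ R.mass + S.mass := add_le_add hR'm hS'm
      _ < δ := hmass

/-- **King's tangent cone theorem in positive dimension, from the compactness theorem 4.2.17 and
the boundary rectifiability theorem 4.2.16 (2)** — the statement of
`King1971_tangentCone_pos_of_boundaryRectifiability` with the (redundant) compactness hypothesis
`Federer1969_compactness_integralCurrents`, kept for its users.
[cite: Harvey1977, Thm. 1.31; Federer1969, 4.3.16, 4.2.17, 4.2.16] -/
theorem King1971_tangentCone_pos_of_compactness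
    (_h417 : Federer1969_compactness_integralCurrents.{u})
    (h4216 : ∀ (E : Type u) [NormedAddCommGroup E] [InnerProductSpace ℝ E] [FiniteDimensional ℝ E]
      [MeasurableSpace E] [BorelSpace E] (m : ℕ) (P : Current (⊤ : Opens E) (m + 1)),
      P.IsRectifiable → P.boundary.mass ≠ ⊤ → P.boundary.IsRectifiable)
    (Ω : Opens V) (q : ℕ) (T : HolomorphicChain 𝓘(ℂ, V) Ω (q + 1)) (b : V) (hb : b ∈ Ω) :
    letI : InnerProductSpace ℝ V := InnerProductSpace.complexToReal
    ∃ C : HolomorphicChain 𝓘(ℂ, V) (⊤ : Opens V) (q + 1),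
      (∀ x ∈ C.support, ∀ c : ℂ, (⟨c • (x : V), trivial⟩ : (⊤ : Opens V)) ∈ C.support) ∧
      ∀ (W : Set V), IsOpen W → IsCompact (closure W) → closure W ⊆ ball (0 : V) 1 →
        ∀ δ : ℝ≥0∞, 0 < δ → ∀ᶠ r in 𝓝[>] (0 : ℝ),
          ∃ (R : Current (unitBall V) (2 * (q + 1))) (S : Current (unitBall V) (2 * (q + 1) + 1)),
            R.IsRectifiable ∧ S.IsRectifiable ∧
            (T.blowUp b r - C.toCurrentIn (unitBall V) - R - S.boundary).support ∩ W = ∅ ∧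
            R.mass + S.mass < δ :=
  King1971_tangentCone_pos_of_boundaryRectifiability h4216 Ω q T b hb

/-- **King's tangent cone theorem for `0`-chains**, unconditionally: the support of a
holomorphic `0`-chain consists of regular points (`HasPureDim.mem_regularLocus_of_zero`), so every
base point lies off the singular locus and `King1971_tangentCone_of_notMem_singular` applies.
[cite: Harvey1977, Thm. 1.31] -/
theorem King1971_tangentCone_zero (Ω : Opens V) (T : HolomorphicChain 𝓘(ℂ, V) Ω 0) (b : V)
    (hb : b ∈ Ω) :
    letI : InnerProductSpace ℝ V := InnerProductSpace.complexToReal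
    ∃ C : HolomorphicChain 𝓘(ℂ, V) (⊤ : Opens V) 0,
      (∀ x ∈ C.support, ∀ c : ℂ, (⟨c • (x : V), trivial⟩ : (⊤ : Opens V)) ∈ C.support) ∧
      ∀ (W : Set V), IsOpen W → IsCompact (closure W) → closure W ⊆ ball (0 : V) 1 →
        ∀ δ : ℝ≥0∞, 0 < δ → ∀ᶠ r in 𝓝[>] (0 : ℝ),
          ∃ (R : Current (unitBall V) (2 * 0)) (S : Current (unitBall V) (2 * 0 + 1)),
            R.IsRectifiable ∧ S.IsRectifiable ∧
            (T.blowUp b r - C.toCurrentIn (unitBall V) - R - S.boundary).support ∩ W = ∅ ∧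
            R.mass + S.mass < δ := by
  haveI : LocallyCompactSpace Ω := Ω.isOpen.locallyCompactSpace
  refine King1971_tangentCone_of_notMem_singular V Ω 0 T b hb ?_
  rintro ⟨⟨x, hx, hxb⟩, hnc⟩
  have hA : HasPureDim 𝓘(ℂ, V) T.support 0 := T.hasPureDim_support ⟨x, hx⟩
  exact hnc ⟨x, hA.mem_regularLocus_of_zero hx, hxb⟩

/-- **King's tangent cone theorem from the boundary rectifiability theorem 4.2.16 (2)**: the named
fact `Literature.Geometry.Kaehler.King1971_tangentCone` in all dimensions (`p = 0`:
`King1971_tangentCone_zero`; `p ≥ 1`: `King1971_tangentCone_pos_of_boundaryRectifiability`).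
[cite: Harvey1977, Thm. 1.31; Federer1969, 4.3.16, 4.2.17, 4.2.16] -/
theorem King1971_tangentCone_of_boundaryRectifiability'
    (h4216 : ∀ (E : Type u) [NormedAddCommGroup E] [InnerProductSpace ℝ E] [FiniteDimensional ℝ E]
      [MeasurableSpace E] [BorelSpace E] (m : ℕ) (P : Current (⊤ : Opens E) (m + 1)),
      P.IsRectifiable → P.boundary.mass ≠ ⊤ → P.boundary.IsRectifiable) :
    King1971_tangentCone.{u} := by
  intro V _ _ _ _ _ Ω p T b hb
  cases p with
  | zero => exact King1971_tangentCone_zero Ω T b hb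
  | succ q => exact King1971_tangentCone_pos_of_boundaryRectifiability h4216 Ω q T b hb

/-- **King's tangent cone theorem from the boundary rectifiability theorem**: the named fact
`Federer1969_boundaryRectifiability` [Federer1969, 4.2.16 (2)] alone implies
`King1971_tangentCone` (the compactness input, in its flat-Cauchy form, being the tree's theorem
`Current.exists_subseq_flatLimit_of_isIntegral`). [cite: Harvey1977, Thm. 1.31; Federer1969, 4.3.16] -/
theorem King1971_tangentCone_of_boundaryRectifiability
    (h4216 : Federer1969_boundaryRectifiability.{u}) : King1971_tangentCone.{u} :=
  King1971_tangentCone_of_boundaryRectifiability' h4216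

/-- **King's tangent cone theorem from the compactness theorem 4.2.17 and the boundary
rectifiability theorem 4.2.16 (2)**: the named fact
`Literature.Geometry.Kaehler.King1971_tangentCone` in all dimensions; the compactness hypothesis
is redundant (`King1971_tangentCone_of_boundaryRectifiability'`), the statement is kept for its
users. [cite: Harvey1977, Thm. 1.31; Federer1969, 4.3.16, 4.2.17, 4.2.16] -/
theorem King1971_tangentCone_of_compactness
    (_h417 : Federer1969_compactness_integralCurrents.{u})
    (h4216 : ∀ (E : Type u) [NormedAddCommGroup E] [InnerProductSpace ℝ E] [FiniteDimensional ℝ E]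
      [MeasurableSpace E] [BorelSpace E] (m : ℕ) (P : Current (⊤ : Opens E) (m + 1)),
      P.IsRectifiable → P.boundary.mass ≠ ⊤ → P.boundary.IsRectifiable) :
    King1971_tangentCone.{u} :=
  King1971_tangentCone_of_boundaryRectifiability' h4216

/-- **King's tangent cone theorem from the two named facts of the general theory**: the
compactness theorem `Federer1969_compactness_integralCurrents` [Federer1969, 4.2.17 (2)] and the
boundary rectifiability theorem `Federer1969_boundaryRectifiability` [Federer1969, 4.2.16 (2)]
imply `King1971_tangentCone`; the first hypothesis is redundant
(`King1971_tangentCone_of_boundaryRectifiability`), the statement is kept for its users.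
[cite: Harvey1977, Thm. 1.31; Federer1969, 4.3.16] -/
theorem King1971_tangentCone_of_facts (_h417 : Federer1969_compactness_integralCurrents.{u})
    (h4216 : Federer1969_boundaryRectifiability.{u}) : King1971_tangentCone.{u} :=
  King1971_tangentCone_of_boundaryRectifiability h4216

end Reduction

end Literature.Geometry.Kaehler
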